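import Literature.NumberTheory.Automorphic.OrbitalIntegralFixedPointsPerPeriodQuotient   -- ★ p842951 (N1b): `classOrbitalIntegral_indicator_eq_mul_natCard_quotient_orbitRel`
import Literature.NumberTheory.Automorphic.CompactCoreCentralizerNonarch                 -- ★ `exists_subgroup_coe_eq_compactCore` (commutative ⇒ the compact core is a subgroup)
import HarnessLib

/-!
# The per-period unit orbital integral of a SPLIT TORUS: `O_γ(1_K) = ν(K) · #(Fix_γ(G ⧸ K) ∕ τ^ℤ)` from a TRANSLATION `τ ∈ Z_G(γ)` generating the centraliser modulo
# its compact core (Kottwitz 1988 §2; Laumon 1996 (5.3.2); Serre, *Trees* II.1.1: the split torus acts on its apartment by translations)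

Topic `NumberTheory/Automorphic`; namespace `Literature.NumberTheory.Automorphic`.  THEOREMS ONLY (no definition, no instance, no notation, no named fact, no `sorry`).
Cell `pub/hodgecm-mathlib`, F0∕P3a, crux H413 = stmt-HodgeConjecture-24833, line «N6nsGerm», (R2) Euler–Poincaré road, RAMIFIED half census
`F0/P3a/A-p06/g27/CENSUS-R2ram-RamifiedEulerPoincare.A-p06g27.md` §4 (S4) (LEAD F0P3a-plan (g10) T9-8 (B); seat A-p06 (g27)).  HONEST LABEL: HC_CM is proved only modulo the
printed citations until rung 0 closes.

WHAT.  ★ (N1b) `classOrbitalIntegral_indicator_eq_mul_natCard_quotient_orbitRel` wants two subgroups `C₀, A ≤ Z_G(γ)`: `C₀` compact open containing the compact core,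
`A` a complement (`Z = A·C₀`, `A ∩ C₀ = 1`).  For a SPLIT TORUS (`Z_G(γ) ≅ L_w^× = ϖ^ℤ × 𝒪_w^×`) the natural data is ONE element `τ ∈ Z_G(γ)` (the image of `ϖ`) with
(gen) every `c ∈ Z_G(γ)` is `τ^n · c₀` with `c₀` in the compact core, and (free) `τ^n` in the compact core only for `n = 0`.  This file packages (gen)+(free) into
the `(C₀, A)` of ★ (N1b): `C₀ := compactCore Z_G(γ)` — a subgroup because `Z_G(γ)` is COMMUTATIVE (★ `exists_subgroup_coe_eq_compactCore`), compact and open by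
hypothesis (★ `CompactCoreCentralizerUnitary` supplies both for regular semisimple elements of unitary groups) — and `A := τ^ℤ = Subgroup.zpowers τ`.

* `exists_compactCore_complement_of_generator` — the `(C₀, A)` package from `τ` (pure topological-group algebra).
* **`classOrbitalIntegral_indicator_eq_mul_natCard_quotient_zpowers`** — `classOrbitalIntegral m 1_K ⟦γ⟧ = ν(K) · #(Fix_γ(G ⧸ K) ∕ τ^ℤ)` for `m` canonical,
  commutative centraliser with compact open compact core, `τ` as above (+ `ℂ` twin, + finiteness of the quotient).

## References
* [Kottwitz1988] R. E. Kottwitz, *Tamagawa numbers*, Ann. of Math. 127 (1988), §2 Theorem 2.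
* [Laumon1995] G. Laumon, *Cohomology of Drinfeld Modular Varieties* I (1996), Lemma (5.3.2) p. 136.
* [Serre1980Trees] J.-P. Serre, *Trees* (1980), II.1.1.
* [Tits1979] J. Tits, *Reductive groups over local fields*, Corvallis (1979), §3.9 (the maximal compact subgroup of `T(k)`).
-/

set_option autoImplicit false

noncomputable section

open MeasureTheory Measure Topology Set
open scoped ENNReal NNReal

namespace Literature.NumberTheory.Automorphic

/-! ## §1 The `(C₀, A)` package from a generator `τ` -/

section Package

variable {Z : Type*} [Group Z] [TopologicalSpace Z] [IsTopologicalGroup Z]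

/-- **The compact core and the translation lattice `τ^ℤ` decompose a commutative group**: if `Z` is commutative with compact open compact core, and `τ ∈ Z` satisfies
(gen) `∀ c, ∃ n : ℤ, c * τ^(-n) ∈ compactCore Z` and (free) `τ ^ n ∈ compactCore Z → n = 0`, then there are subgroups `C₀` (`= compactCore Z`, compact open) and
`A = zpowers τ` with `Z = A · C₀` and `A ∩ C₀ = 1` — the hypotheses of ★ (N1b). [cite: Tits1979, §3.9] [cite: Serre1980Trees, II.1.1] -/
theorem exists_compactCore_complement_of_generator (hcomm : ∀ a b : Z, a * b = b * a) (hc : IsCompact (compactCore Z)) (ho : IsOpen (compactCore Z))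
    (τ : Z) (hgen : ∀ c : Z, ∃ n : ℤ, c * (τ ^ n)⁻¹ ∈ compactCore Z) (hfree : ∀ n : ℤ, τ ^ n ∈ compactCore Z → n = 0) :
    ∃ C₀ : Subgroup Z, (C₀ : Set Z) = compactCore Z ∧ IsCompact (C₀ : Set Z) ∧ IsOpen (C₀ : Set Z) ∧ compactCore Z ⊆ C₀ ∧
      (∀ c : Z, ∃ a ∈ Subgroup.zpowers τ, ∃ c₀ ∈ C₀, c = a * c₀) ∧ (∀ a : Z, a ∈ Subgroup.zpowers τ → a ∈ C₀ → a = 1) := by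
  obtain ⟨C₀, hC₀⟩ := exists_subgroup_coe_eq_compactCore hcomm
  have hmem : ∀ z : Z, z ∈ C₀ ↔ z ∈ compactCore Z := fun z => by rw [← hC₀]; rfl
  refine ⟨C₀, hC₀, hC₀ ▸ hc, hC₀ ▸ ho, fun z hz => (hmem z).2 hz, fun c => ?_, fun a ha haC => ?_⟩
  · obtain ⟨n, hn⟩ := hgen c
    refine ⟨τ ^ n, ⟨n, rfl⟩, c * (τ ^ n)⁻¹, (hmem _).2 hn, ?_⟩
    rw [hcomm (τ ^ n) (c * (τ ^ n)⁻¹), inv_mul_cancel_right]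
  · obtain ⟨n, hn⟩ := ha
    have hn' : a = τ ^ n := hn.symm
    subst hn'
    have h0 : n = 0 := hfree n ((hmem _).1 haC)
    rw [h0, zpow_zero]

end Package

/-! ## §2 The per-period class reading for a split torus -/

section PerPeriod

variable {G : Type*} [Group G] [TopologicalSpace G] [IsTopologicalGroup G] [LocallyCompactSpace G]
  [SecondCountableTopology G] [T2Space G] [MeasurableSpace G] [BorelSpace G]
  [∀ γ : G, MeasurableSpace (G ⧸ Subgroup.centralizer ({γ} : Set G))]
  [∀ γ : G, BorelSpace (G ⧸ Subgroup.centralizer ({γ} : Set G))]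

/-- **`classOrbitalIntegral m 1_K ⟦γ⟧ = ν(K) · #(Fix_γ(G ⧸ K) ∕ τ^ℤ)` for a SPLIT TORUS.**  `m` canonical for `(P, ν)`, `P` conjugation-invariant with `P γ`, the class of `γ`
closed, `K` compact open; the centraliser `Z_G(γ)` commutative with compact open compact core; `τ ∈ Z_G(γ)` with (gen) and (free).  Then also the quotient is FINITE.
(The (N)-side term of ★ `RankOneEulerPoincareGlue` at a non-elliptic regular `γ`: `ν(K)⁻¹ Φ(⟦γ⟧, 1_K)` = number of `γ`-fixed points of `G ⧸ K` per period of `τ`.)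
[cite: Kottwitz1988, §2 Theorem 2] [cite: Laumon1995, Lemma (5.3.2) p. 136] [cite: Serre1980Trees, II.1.1] -/
theorem classOrbitalIntegral_indicator_eq_mul_natCard_quotient_zpowers {P : G → Prop} (hP : ∀ g x : G, P g → P (x * g * x⁻¹))
    {ν : Measure G} [ν.IsHaarMeasure] [ν.IsMulRightInvariant] {m : OrbitalMeasureFamily G} (hm : m.IsCanonical P ν)
    {γ : G} (hγ : P γ) (hcomm : ∀ a b : Subgroup.centralizer ({γ} : Set G), a * b = b * a)
    (hc : IsCompact (compactCore (Subgroup.centralizer ({γ} : Set G)))) (ho : IsOpen (compactCore (Subgroup.centralizer ({γ} : Set G))))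
    (τ : Subgroup.centralizer ({γ} : Set G))
    (hgen : ∀ c : Subgroup.centralizer ({γ} : Set G), ∃ n : ℤ, c * (τ ^ n)⁻¹ ∈ compactCore (Subgroup.centralizer ({γ} : Set G)))
    (hfree : ∀ n : ℤ, τ ^ n ∈ compactCore (Subgroup.centralizer ({γ} : Set G)) → n = 0)
    (K : Subgroup G) (hK : IsOpen (K : Set G)) (hKc : IsCompact (K : Set G)) (hO : IsClosed {g | ∃ y : G, y * γ * y⁻¹ = g}) :
    Finite (Quotient ((MulAction.orbitRel (Subgroup.zpowers τ) (G ⧸ K)).comap (Subtype.val : MulAction.fixedBy (G ⧸ K) γ → G ⧸ K))) ∧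
    classOrbitalIntegral m ((K : Set G).indicator (1 : G → ℝ)) (ConjClasses.mk γ) =
      (ν K).toReal * Nat.card (Quotient ((MulAction.orbitRel (Subgroup.zpowers τ) (G ⧸ K)).comap (Subtype.val : MulAction.fixedBy (G ⧸ K) γ → G ⧸ K))) := by
  obtain ⟨C₀, -, hC₀c, hC₀o, hcore, hprod, hdisj⟩ := exists_compactCore_complement_of_generator hcomm hc ho τ hgen hfree
  exact ⟨finite_quotient_orbitRel_fixedBy_of_isClosed γ K C₀ (Subgroup.zpowers τ) hO hK hKc hC₀c hcore hprod hdisj,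
    classOrbitalIntegral_indicator_eq_mul_natCard_quotient_orbitRel hP hm hγ hcomm C₀ (Subgroup.zpowers τ) hC₀c hC₀o hcore hprod hdisj K hK hKc hO⟩

/-- `ℂ`-valued twin. [cite: Kottwitz1988, §2 Theorem 2] [cite: Laumon1995, Lemma (5.3.2) p. 136] -/
theorem classOrbitalIntegral_indicator_complex_eq_mul_natCard_quotient_zpowers {P : G → Prop} (hP : ∀ g x : G, P g → P (x * g * x⁻¹))
    {ν : Measure G} [ν.IsHaarMeasure] [ν.IsMulRightInvariant] {m : OrbitalMeasureFamily G} (hm : m.IsCanonical P ν)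
    {γ : G} (hγ : P γ) (hcomm : ∀ a b : Subgroup.centralizer ({γ} : Set G), a * b = b * a)
    (hc : IsCompact (compactCore (Subgroup.centralizer ({γ} : Set G)))) (ho : IsOpen (compactCore (Subgroup.centralizer ({γ} : Set G))))
    (τ : Subgroup.centralizer ({γ} : Set G))
    (hgen : ∀ c : Subgroup.centralizer ({γ} : Set G), ∃ n : ℤ, c * (τ ^ n)⁻¹ ∈ compactCore (Subgroup.centralizer ({γ} : Set G)))
    (hfree : ∀ n : ℤ, τ ^ n ∈ compactCore (Subgroup.centralizer ({γ} : Set G)) → n = 0)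
    (K : Subgroup G) (hK : IsOpen (K : Set G)) (hKc : IsCompact (K : Set G)) (hO : IsClosed {g | ∃ y : G, y * γ * y⁻¹ = g}) :
    classOrbitalIntegral m ((K : Set G).indicator fun _ => (1 : ℂ)) (ConjClasses.mk γ) =
      (((ν K).toReal : ℝ) : ℂ) *
        (Nat.card (Quotient ((MulAction.orbitRel (Subgroup.zpowers τ) (G ⧸ K)).comap (Subtype.val : MulAction.fixedBy (G ⧸ K) γ → G ⧸ K))) : ℂ) := by
  obtain ⟨C₀, -, hC₀c, hC₀o, hcore, hprod, hdisj⟩ := exists_compactCore_complement_of_generator hcomm hc ho τ hgen hfree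
  exact classOrbitalIntegral_indicator_complex_eq_mul_natCard_quotient_orbitRel hP hm hγ hcomm C₀ (Subgroup.zpowers τ) hC₀c hC₀o hcore hprod hdisj K hK hKc hO

end PerPeriod

end Literature.NumberTheory.Automorphic

end
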